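import Literature.NumberTheory.LFunctions.ClassGroupPairExplicitFormula
import Literature.NumberTheory.LFunctions.SymmetricHadamardNodes
import HarnessLib

/-!
# Deuring–Heilbronn for class group `L`-functions, I: one character as a weighted node family

Topic `Literature/NumberTheory/LFunctions` (namespace `Literature.NumberTheory.LFunctions.NumberField.DH`).
Everything here is PROVED; `SlotIdx`, `slotNode`, `slotWt`, `poleInd` are definitions with bodies.

For a class group character `ψ` of `K`, a point `s` with `Re s > 1` and `D : SymmHadamardData (Ξ_ψ)`
(`Ξ_ψ = ξ(·,ψ)ξ(·,ψ⁻¹)`, `ClassGroupXiPair.lean`) we index ALL the "zeros" entering the explicit formula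
for `P_k(ψ, s)` (`pairLSeries_explicit`) by `SlotIdx = (ℕ × Bool) ⊕ Unit ⊕ ℕ`:

* `inl (n, ±)`: the zeros `1/2 ± ζₙ` of `Ξ_ψ` (weight `1`, or `0` on padding indices),
* `inr (inl ())`: the point `1/2` (weight `2m`, the order of `Ξ_ψ` there),
* `inr (inr j)`: the trivial zero `−j` (weight `2(r₁·[j even] + r₂) − 2δ_ψ·[j = 0]`, `δ_ψ = [ψ = 1]`;
  the `−2δ_ψ` nets the term `+2s^{−k−1}` of the pole factor `s(s−1)` against the trivial zero at `0`).

Results (`k + 1 = 2μ`, `μ ≥ 1`):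

* `hasSum_slot` — `Σ_i w_i (s − ω_i)^{−2μ} = 2δ_ψ (s−1)^{−2μ} + 2(1−δ_ψ)((s−1)^{−2μ} + s^{−2μ}) − P_{2μ−1}(ψ, s)`;
* `slotWt_nonneg`, `one_le_slotWt_of_pos`, `slotNode_re_le_one` — weights `≥ 0`, in fact `0` or `≥ 1`;
  nodes of positive weight have `Re ω ≤ 1`;
* `summable_slotWt_mul_norm`, `tsum_slotWt_mul_norm_le` — the `M`-bound
  `Σ_i w_i |s − ω_i|^{−2} ≤ (Re s − 1)^{−1}(Re[2/s + 2/(s−1) + 2γ_K'/γ_K(s)] − Re P_0(ψ,s)) + 2 n_K`;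
* `exists_idx_of_classGroupLFunction_eq_zero` — a zero `ρ` of `L(·, ψ)` with `Re ρ > 0`, `ρ ≠ 1` is a
  node of positive weight; `exists_two_idx_of_double` — a double zero `ρ ∉ {1/2}` of `Ξ_ψ` is carried by
  two distinct indices of weight `1` (used for `ρ = 1`, `ψ ≠ 1`, and for `ρ = β₁`, `ψ` real).

[cite: ThornerZaman2017, §7.2 (7.7)–(7.8)] [cite: LagariasMontgomeryOdlyzko1979, §4]

## References

* J. Thorner, A. Zaman, Algebra Number Theory 11 (2017), §7. [ThornerZaman2017]
* J. C. Lagarias, H. L. Montgomery, A. M. Odlyzko, Invent. Math. 54 (1979), §3–4. [LagariasMontgomeryOdlyzko1979]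
-/

noncomputable section

open scoped NumberField
open Complex Filter Topology Set NumberField NumberField.InfinitePlace Classical

namespace Literature.NumberTheory.LFunctions.NumberField

open Literature.NumberTheory.LFunctions.Stark1974

namespace DH

variable {K : Type*} [Field K] [NumberField K]

/-- The index type of one character's node family. [folklore] -/
abbrev SlotIdx : Type := (ℕ × Bool) ⊕ (Unit ⊕ ℕ)

/-- `δ_ψ = 1` if `ψ = 1`, else `0`. [folklore] -/
def poleInd (ψ : ClassGroup (𝓞 K) →* ℂˣ) : ℝ := if ψ = 1 then 1 else 0

/-- The nodes: zeros `1/2 ± ζₙ`, the point `1/2`, the trivial zeros `−j`. [cite: ThornerZaman2017, §7.2 (7.8)] -/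
def slotNode {ψ : ClassGroup (𝓞 K) →* ℂˣ} (D : SymmHadamardData (classXiPair K ψ)) : SlotIdx → ℂ
  | Sum.inl p => D.nodeVal p
  | Sum.inr (Sum.inl _) => 1 / 2
  | Sum.inr (Sum.inr j) => -(j : ℂ)

variable (K) in
/-- The weight of the trivial zero `−j`: `2(r₁[j even] + r₂) − 2δ_ψ[j = 0]`. [cite: ThornerZaman2017, §2 (2.4)] -/
def trivWt (ψ : ClassGroup (𝓞 K) →* ℂˣ) (j : ℕ) : ℝ :=
  2 * ((if Even j then (nrRealPlaces K : ℝ) else 0) + nrComplexPlaces K) - 2 * poleInd ψ * (if j = 0 then 1 else 0)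

/-- The weights. [cite: ThornerZaman2017, §7.2 (7.8)] -/
def slotWt {ψ : ClassGroup (𝓞 K) →* ℂˣ} (D : SymmHadamardData (classXiPair K ψ)) : SlotIdx → ℝ
  | Sum.inl p => D.nodeWt p
  | Sum.inr (Sum.inl _) => 2 * D.m
  | Sum.inr (Sum.inr j) => trivWt K ψ j

/-- `δ_ψ ∈ {0, 1}`. [folklore] -/
theorem poleInd_nonneg (ψ : ClassGroup (𝓞 K) →* ℂˣ) : 0 ≤ poleInd ψ ∧ poleInd ψ ≤ 1 := by
  unfold poleInd; split_ifs <;> norm_num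

/-- `r₁ + r₂ ≥ 1`. [folklore] -/
theorem one_le_nrRealPlaces_add_nrComplexPlaces : (1 : ℝ) ≤ nrRealPlaces K + nrComplexPlaces K := by
  have h := card_add_two_mul_card_eq_rank K
  have hn : 0 < Module.finrank ℚ K := Module.finrank_pos
  have : 1 ≤ nrRealPlaces K + nrComplexPlaces K := by
    rw [nrRealPlaces, nrComplexPlaces] at *; omega
  exact_mod_cast this

/-- `r₁ + r₂ ≤ n_K`. [folklore] -/
theorem nrRealPlaces_add_nrComplexPlaces_le : (nrRealPlaces K : ℝ) + nrComplexPlaces K ≤ Module.finrank ℚ K := by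
  have h := card_add_two_mul_card_eq_rank K
  have : nrRealPlaces K + nrComplexPlaces K ≤ Module.finrank ℚ K := by
    rw [nrRealPlaces, nrComplexPlaces] at *; omega
  exact_mod_cast this

/-- The trivial-zero weights are `≥ 0`, and `0` or `≥ 1`... in fact even integers; we record
`0 ≤ w ≤ 2 n_K` and `w > 0 → 1 ≤ w`. [folklore] -/
theorem trivWt_nonneg (ψ : ClassGroup (𝓞 K) →* ℂˣ) (j : ℕ) : 0 ≤ trivWt K ψ j := by
  have h1 := one_le_nrRealPlaces_add_nrComplexPlaces (K := K)
  have hp := poleInd_nonneg ψ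
  have hr2 : (0 : ℝ) ≤ nrComplexPlaces K := Nat.cast_nonneg _
  have hr1 : (0 : ℝ) ≤ nrRealPlaces K := Nat.cast_nonneg _
  unfold trivWt
  by_cases h0 : j = 0
  · subst h0
    simp only [Even.zero, if_true]
    nlinarith
  · simp only [h0, if_false, mul_zero, sub_zero]
    split_ifs <;> nlinarith

/-- `trivWt ≤ 2 n_K`. [folklore] -/
theorem trivWt_le (ψ : ClassGroup (𝓞 K) →* ℂˣ) (j : ℕ) : trivWt K ψ j ≤ 2 * Module.finrank ℚ K := by
  have h1 := nrRealPlaces_add_nrComplexPlaces_le (K := K)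
  have hp := poleInd_nonneg ψ
  have hr1 : (0 : ℝ) ≤ nrRealPlaces K := Nat.cast_nonneg _
  unfold trivWt
  split_ifs <;> nlinarith

/-- A positive trivial-zero weight is `≥ 1` (the weights are even integers). [folklore] -/
theorem one_le_trivWt_of_pos (ψ : ClassGroup (𝓞 K) →* ℂˣ) {j : ℕ} (h : 0 < trivWt K ψ j) : 1 ≤ trivWt K ψ j := by
  -- `trivWt = 2 · (integer)`
  have : ∃ z : ℤ, trivWt K ψ j = 2 * z := by
    unfold trivWt poleInd
    refine ⟨(if Even j then (nrRealPlaces K : ℤ) else 0) + nrComplexPlaces K -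
      (if ψ = 1 then 1 else 0) * (if j = 0 then 1 else 0), ?_⟩
    split_ifs <;> push_cast <;> ring
  obtain ⟨z, hz⟩ := this
  rw [hz] at h ⊢
  have : (0 : ℤ) < z := by exact_mod_cast (show (0 : ℝ) < z by linarith)
  have : (1 : ℝ) ≤ z := by exact_mod_cast this
  linarith

section basic

variable {ψ : ClassGroup (𝓞 K) →* ℂˣ} (D : SymmHadamardData (classXiPair K ψ))

/-- **The weights are non-negative.** [folklore] -/
theorem slotWt_nonneg (i : SlotIdx) : 0 ≤ slotWt D i := by
  rcases i with p | u | j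
  · exact D.nodeWt_nonneg p
  · simp [slotWt]
  · exact trivWt_nonneg ψ j

/-- **A positive weight is at least `1`.** [folklore] -/
theorem one_le_slotWt_of_pos {i : SlotIdx} (h : 0 < slotWt D i) : 1 ≤ slotWt D i := by
  rcases i with p | u | j
  · simp only [slotWt] at h ⊢; rw [D.nodeWt_eq_one_of_pos h]
  · simp only [slotWt] at h ⊢
    have : 0 < D.m := by exact_mod_cast (show (0 : ℝ) < D.m by linarith)
    have : (1 : ℝ) ≤ D.m := by exact_mod_cast this
    linarith
  · exact one_le_trivWt_of_pos ψ h

/-- **The nodes of positive weight lie in `Re ≤ 1`.** [folklore] -/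
theorem slotNode_re_le_one {i : SlotIdx} (h : 0 < slotWt D i) : (slotNode D i).re ≤ 1 := by
  rcases i with p | u | j
  · exact D.nodeVal_re_le_one h
  · simp [slotNode]; norm_num
  · simp [slotNode]
    linarith [(j.cast_nonneg : (0 : ℝ) ≤ j)]

end basic

/-! ### Zeros are nodes -/

section zeros

variable {ψ : ClassGroup (𝓞 K) →* ℂˣ} (D : SymmHadamardData (classXiPair K ψ))

/-- A zero of `Ξ_ψ` is a node of positive weight (with that value). [folklore] -/
theorem exists_idx_of_classXiPair_eq_zero {ρ : ℂ} (hρ : classXiPair K ψ ρ = 0) :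
    ∃ i : SlotIdx, 0 < slotWt D i ∧ slotNode D i = ρ := by
  by_cases h : ρ = 1 / 2
  · refine ⟨Sum.inr (Sum.inl ()), ?_, by simp [slotNode, h]⟩
    simp only [slotWt]
    -- `m ≥ 1` since `Ξ(1/2) = 0`
    have hm : D.m ≠ 0 := by
      intro hm
      have := D.apply_eq (1 / 2 : ℂ)
      rw [← h, hρ, hm, mul_zero, pow_zero, one_mul, h, sub_self] at this
      simp only [ne_eq, OfNat.ofNat_ne_zero, not_false_eq_true, zero_pow, mul_zero, add_zero,
        tprod_one, mul_one] at this
      exact D.A_ne this.symm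
    have : (1 : ℝ) ≤ D.m := by exact_mod_cast Nat.one_le_iff_ne_zero.mpr hm
    linarith
  · obtain ⟨p, hp, hpv⟩ := D.exists_nodeVal_eq_of_zero hρ h
    exact ⟨Sum.inl p, by simp [slotWt, hp], by simp [slotNode, hpv]⟩

/-- **A zero `ρ` of `L(·, ψ)` with `Re ρ > 0`, `ρ ≠ 1` is a node of positive weight.** [folklore] -/
theorem exists_idx_of_classGroupLFunction_eq_zero {ρ : ℂ} (hρ0 : 0 < ρ.re) (hρ1 : ρ ≠ 1)
    (hρ : classGroupLFunction K ψ ρ = 0) : ∃ i : SlotIdx, 0 < slotWt D i ∧ slotNode D i = ρ := by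
  apply exists_idx_of_classXiPair_eq_zero
  rw [classXiPair, classXi_eq_zero_of_classGroupLFunction_eq_zero ψ hρ0 hρ1 hρ, zero_mul]

/-- **A multiple zero `ρ ≠ 1/2` of `Ξ_ψ` is carried by two distinct node indices of weight `1`, whose
twin nodes are `1 − ρ`.** [folklore] -/
theorem exists_two_idx_of_double {ρ : ℂ} (hρ : classXiPair K ψ ρ = 0) (hρ' : deriv (classXiPair K ψ) ρ = 0)
    (h : ρ ≠ 1 / 2) :
    ∃ p₁ p₂ : ℕ × Bool, p₁ ≠ p₂ ∧ D.nodeWt p₁ = 1 ∧ D.nodeWt p₂ = 1 ∧ D.nodeVal p₁ = ρ ∧ D.nodeVal p₂ = ρ ∧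
      D.nodeVal (p₁.1, !p₁.2) = 1 - ρ ∧ D.nodeVal (p₂.1, !p₂.2) = 1 - ρ := by
  obtain ⟨n₁, n₂, hne, h₁, h₂⟩ := D.exists_two_indices_of_deriv_eq_zero hρ hρ' h
  obtain ⟨b₁, hb₁, hb₁'⟩ := D.nodeVal_pair_of_root h₁
  obtain ⟨b₂, hb₂, hb₂'⟩ := D.nodeVal_pair_of_root h₂
  have hc₁ : D.c n₁ ≠ 0 := by rintro h0; rw [h0, zero_mul] at h₁; norm_num at h₁
  have hc₂ : D.c n₂ ≠ 0 := by rintro h0; rw [h0, zero_mul] at h₂; norm_num at h₂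
  exact ⟨(n₁, b₁), (n₂, b₂), fun h ↦ hne (congrArg Prod.fst h), D.nodeWt_eq_one_iff.mpr hc₁,
    D.nodeWt_eq_one_iff.mpr hc₂, hb₁, hb₂, hb₁', hb₂'⟩

end zeros

/-! ### The node sum of one character -/

section nodeSum

variable {ψ : ClassGroup (𝓞 K) →* ℂˣ} (D : SymmHadamardData (classXiPair K ψ)) {s : ℂ}

/-- `|s + j| ≥ 1 + j` for `Re s ≥ 1`. [folklore] -/
theorem one_add_le_norm_add_nat (hs : 1 ≤ s.re) (j : ℕ) : 1 + (j : ℝ) ≤ ‖s + j‖ := by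
  have := abs_re_le_norm (s + j)
  rw [add_re, natCast_re] at this
  have h2 : s.re + j ≤ |s.re + j| := le_abs_self _
  linarith

/-- The trivial-zero terms `(s + j)^{−2μ}` are absolutely summable for `Re s ≥ 1`, `μ ≥ 1`. [folklore] -/
theorem summable_norm_inv_pow_add_nat (hs : 1 ≤ s.re) {m : ℕ} (hm : 2 ≤ m) :
    Summable fun j : ℕ ↦ ‖((s + j) ^ m)⁻¹‖ := by
  have hb : Summable fun j : ℕ ↦ 1 / ((j : ℝ) + 1) ^ 2 :=
    Literature.Analysis.SpecialFunctions.Complex.summable_one_div_nat_add_one_sq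
  refine Summable.of_nonneg_of_le (fun j ↦ norm_nonneg _) (fun j ↦ ?_) hb
  have h1 := one_add_le_norm_add_nat hs j
  have hpos : 0 < 1 + (j : ℝ) := by positivity
  rw [norm_inv, norm_pow, one_div]
  calc (‖s + j‖ ^ m)⁻¹ ≤ ((1 + (j : ℝ)) ^ m)⁻¹ := by
        apply inv_anti₀ (by positivity)
        exact pow_le_pow_left₀ hpos.le h1 m
    _ ≤ ((1 + (j : ℝ)) ^ 2)⁻¹ := by
        apply inv_anti₀ (by positivity)
        exact pow_le_pow_right₀ (by linarith) hm
    _ = (((j : ℝ) + 1) ^ 2)⁻¹ := by ring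

/-- The even-indexed trivial-zero terms, reindexed: `Σ_j [j even](s+j)^{−m} = Σ_j (s+2j)^{−m}`. [folklore] -/
theorem hasSum_even_trivial (hs : 1 ≤ s.re) {m : ℕ} (hm : 2 ≤ m) :
    HasSum (fun j : ℕ ↦ if Even j then ((s + j) ^ m)⁻¹ else 0) (∑' j : ℕ, ((s + 2 * j) ^ m)⁻¹) ∧
      Summable fun j : ℕ ↦ ((s + 2 * (j : ℂ)) ^ m)⁻¹ := by
  have hS := Summable.of_norm (summable_norm_inv_pow_add_nat hs hm)
  have hinj : Function.Injective (fun j : ℕ ↦ 2 * j) := fun a b h ↦ by simpa using h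
  have h2 : Summable fun j : ℕ ↦ ((s + 2 * (j : ℂ)) ^ m)⁻¹ := by
    refine (hS.comp_injective hinj).congr fun j ↦ ?_
    simp only [Function.comp_apply]; push_cast; ring_nf
  refine ⟨?_, h2⟩
  have h3 := (hasSum_extend_zero hinj).mpr h2.hasSum
  refine h3.congr_fun fun j ↦ ?_
  by_cases hj : Even j
  · obtain ⟨i, rfl⟩ := hj
    rw [if_pos ⟨i, rfl⟩, show i + i = 2 * i by ring, hinj.extend_apply]
    push_cast; ring_nf
  · rw [if_neg hj, Function.extend_apply']
    · rfl
    · rintro ⟨i, rfl⟩; exact hj ⟨i, by ring⟩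

/-- The gamma sum split: `Σ_j (r₁(s+2j)^{−m} + r₂(s+j)^{−m}) = Σ_j (r₁[j even] + r₂)(s+j)^{−m}` as a
`HasSum` over `j`, for `Re s ≥ 1`, `m ≥ 2`. [folklore] -/
theorem hasSum_trivial (hs : 1 ≤ s.re) {m : ℕ} (hm : 2 ≤ m) :
    HasSum (fun j : ℕ ↦ (((if Even j then (nrRealPlaces K : ℝ) else 0) + nrComplexPlaces K : ℝ) : ℂ) *
        ((s + j) ^ m)⁻¹)
      (∑' j : ℕ, ((nrRealPlaces K : ℂ) * ((s + 2 * j) ^ m)⁻¹ + (nrComplexPlaces K : ℂ) * ((s + j) ^ m)⁻¹)) := by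
  have hS := Summable.of_norm (summable_norm_inv_pow_add_nat hs hm)
  obtain ⟨heven, h2⟩ := hasSum_even_trivial hs hm
  have hodd : HasSum (fun j : ℕ ↦ ((s + j) ^ m)⁻¹) (∑' j : ℕ, ((s + j) ^ m)⁻¹) := hS.hasSum
  have hsum := (heven.mul_left (nrRealPlaces K : ℂ)).add (hodd.mul_left (nrComplexPlaces K : ℂ))
  have hval : (nrRealPlaces K : ℂ) * ∑' j : ℕ, ((s + 2 * j) ^ m)⁻¹ +
      (nrComplexPlaces K : ℂ) * ∑' j : ℕ, ((s + j) ^ m)⁻¹ =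
      ∑' j : ℕ, ((nrRealPlaces K : ℂ) * ((s + 2 * j) ^ m)⁻¹ + (nrComplexPlaces K : ℂ) * ((s + j) ^ m)⁻¹) := by
    rw [← tsum_mul_left, ← tsum_mul_left, ← Summable.tsum_add (h2.mul_left _) (hS.mul_left _)]
  rw [← hval]
  refine hsum.congr_fun fun j ↦ ?_
  split_ifs <;> push_cast <;> ring

end nodeSum

end DH

end Literature.NumberTheory.LFunctions.NumberField

end
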